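import Literature.Topology.PlanarFoliations.ProngTails
import HarnessLib

/-!
# The leaf order along a prong tail

Topic: Topology / PlanarFoliations, sequel to `ProngTails.lean`. Along a forward prong tail of an
open leaf at a prong star (`ProngStar.FwdTail`: the forward half-leaf of the base point `p`
consists of the points over the initial arc `{pt j (β, 0) | 0 < β ≤ β₀}`), **moving forward in
the leaf decreases the parameter `β`**: for `q` in the tail, the forward half-leaf of `q` is the
set of tail points of parameter `≤ β(q)` (`FwdTail.mem_fwd_iff_b_le`), so `q < r` in the leaf
order iff `β(r) < β(q)` (`FwdTail.leafLT_iff_b_lt`). Proof: the parameter image of the connected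
forward half-leaf of `q` is connected, contains `β(q)` and accumulates at `0` (the leaf end
converges to `v`), so it contains `(0, β(q)]`; it contains nothing above `β(q)`, for if `β(r) >
β(q)` with `r ≥ q` then likewise the forward half-leaf of `r` reaches the parameter `β(q)`, i.e.
contains `q` (the parameter is injective on the tail), forcing `r = q`. The same backward
(`BwdTail.mem_bwd_iff_b_le`, `BwdTail.leafLT_iff_b_lt`: moving backward decreases `β`).
Consequently the leaf arcs used as links of walks along separatrix graphs do not return into the
tails.

## References

* C. Camacho, A. Lins Neto, *Geometric Theory of Foliations*, Birkhäuser (1985), Ch. VII §2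
  [CamachoLinsNeto1985].
-/

noncomputable section

open Set Filter Function Metric
open _root_.Topology
open Literature.Topology.FourManifolds Literature.Topology.FourManifolds.Foliation

namespace Literature.Topology.PlanarFoliations

variable {X : Type*} [TopologicalSpace X] [T2Space X] [SecondCountableTopology X] {F : Foliation ℝ X} {ι : X → ℂ}
  {v : ℂ} {n : ℕ} {P : ProngStar F ι v n} {x : X} [NoncompactSpace (F.Leaf x)] {hbi : IsBiOriented F}

namespace ProngStar

namespace FwdTail

variable (E : P.FwdTail hbi x)

/-- The parameter `β` is injective on the tail. [folklore] -/
theorem eq_of_b_eq (hι : IsOpenEmbedding ι) {q r : F.Leaf x} (hq : q ∈ fwd hbi E.p) (hr : r ∈ fwd hbi E.p)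
    (h : P.b E.j (ι (Leaf.pt q)) = P.b E.j (ι (Leaf.pt r))) : q = r := by
  obtain ⟨βq, -, hq', -, hbq⟩ := E.mem_S_of_mem_fwd hq
  obtain ⟨βr, -, hr', -, hbr⟩ := E.mem_S_of_mem_fwd hr
  have hpt : ι (Leaf.pt q) = ι (Leaf.pt r) := by rw [hq', hr', ← hbq, ← hbr, h]
  exact Leaf.injective_coe F x (hι.injective hpt)

/-- **The forward half-leaf of a tail point reaches every smaller parameter**: if `q` is in the
tail, `v ∈ ω(L)`, and `0 < β ≤ β(q)`, some point of the forward half-leaf of `q` has parameter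
`β`. [folklore] -/
theorem exists_mem_fwd_b_eq (hι : IsOpenEmbedding ι) (hω : v ∈ omegaSet hbi ι x) {q : F.Leaf x} (hq : q ∈ fwd hbi E.p)
    {β : ℝ} (hβ : 0 < β) (hβq : β ≤ P.b E.j (ι (Leaf.pt q))) :
    ∃ r ∈ fwd hbi q, P.b E.j (ι (Leaf.pt r)) = β := by
  set c : F.Leaf x → ℝ := fun r ↦ P.b E.j (ι (Leaf.pt r)) with hc
  have hsub : fwd hbi q ⊆ fwd hbi E.p := fwd_mono hq
  have hιpt : Continuous fun r : F.Leaf x ↦ ι (Leaf.pt r) := hι.continuous.comp (Leaf.continuous_coe F x)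
  have hcont : ContinuousOn c (fwd hbi q) := by
    have hb : ContinuousOn (P.b E.j) (P.S E.j) := continuous_fst.comp_continuousOn (P.continuousOn_chart E.j)
    exact hb.comp hιpt.continuousOn fun r hr ↦ by obtain ⟨_, _, _, hS, _⟩ := E.mem_S_of_mem_fwd (hsub hr); exact hS
  have hconn : IsPreconnected (c '' fwd hbi q) := (PunctureData.isPreconnected_fwd q).image c hcont
  -- small values: the forward half-leaf of `q` accumulates at `v`
  obtain ⟨ε, hε, hsmall⟩ := P.exists_norm_chart_lt E.j hβ
  obtain ⟨_, ⟨r₁, hr₁, rfl⟩, hdist⟩ : ∃ z ∈ (fun r : F.Leaf x ↦ ι (Leaf.pt r)) '' fwd hbi q, dist z v < ε := by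
    obtain ⟨z, hz, hd⟩ := Metric.mem_closure_iff.1 ((mem_omegaSet_iff.1 hω) q) ε hε
    exact ⟨z, hz, by rwa [dist_comm] at hd⟩
  obtain ⟨_, _, -, hS₁, -⟩ := E.mem_S_of_mem_fwd (hsub hr₁)
  have hc₁ : c r₁ < β := by
    have h := hsmall _ hS₁ hdist
    have h' : |P.b E.j (ι (Leaf.pt r₁))| ≤ ‖P.chart E.j (ι (Leaf.pt r₁))‖ := by
      rw [← Real.norm_eq_abs, P.chart_apply]; exact norm_fst_le (P.b E.j (ι (Leaf.pt r₁)), P.H (ι (Leaf.pt r₁)))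
    exact (le_abs_self _).trans_lt (h'.trans_lt h)
  obtain ⟨r, hr, hcr⟩ : β ∈ c '' fwd hbi q :=
    hconn.Icc_subset ⟨r₁, hr₁, rfl⟩ ⟨q, mem_fwd_self q, rfl⟩ ⟨hc₁.le, hβq⟩
  exact ⟨r, hr, hcr⟩

/-- **Moving forward in the tail decreases the parameter**: for tail points `q`, `r`, `r` is in
the forward half-leaf of `q` iff `β(r) ≤ β(q)`. [folklore] -/
theorem mem_fwd_iff_b_le (hι : IsOpenEmbedding ι) (hω : v ∈ omegaSet hbi ι x) {q r : F.Leaf x} (hq : q ∈ fwd hbi E.p)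
    (hr : r ∈ fwd hbi E.p) : r ∈ fwd hbi q ↔ P.b E.j (ι (Leaf.pt r)) ≤ P.b E.j (ι (Leaf.pt q)) := by
  -- no point of the forward half-leaf of a tail point has a larger parameter
  have key : ∀ {q r : F.Leaf x}, q ∈ fwd hbi E.p → r ∈ fwd hbi q → P.b E.j (ι (Leaf.pt r)) ≤ P.b E.j (ι (Leaf.pt q)) := by
    intro q r hq hr
    by_contra hlt
    rw [not_le] at hlt
    have hrp : r ∈ fwd hbi E.p := fwd_mono hq hr
    obtain ⟨_, hβr, -, -, hbr⟩ := E.mem_S_of_mem_fwd hrp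
    obtain ⟨_, hβq, -, -, hbq⟩ := E.mem_S_of_mem_fwd hq
    -- the forward half-leaf of `r` reaches the parameter of `q`, i.e. contains `q`
    obtain ⟨q', hq', hbq'⟩ := E.exists_mem_fwd_b_eq hι hω hrp (β := P.b E.j (ι (Leaf.pt q))) (by rw [hbq]; exact hβq.1) hlt.le
    have hq'q : q' = q := E.eq_of_b_eq hι (fwd_mono hrp hq') hq hbq'
    rw [hq'q] at hq'
    -- so `q ≥ r ≥ q`: `q = r`
    have hqr : q = r := by
      rcases not_leafLT_iff.1 hr with h | h
      · rcases not_leafLT_iff.1 hq' with h' | h'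
        · exact (leafLT_asymm h h').elim
        · exact h'.symm
      · exact h
    rw [hqr] at hlt
    exact lt_irrefl _ hlt
  refine ⟨key hq, fun hle ↦ ?_⟩
  by_contra hrq
  -- `r < q`, so `q` is in the forward half-leaf of `r`: `β(q) ≤ β(r)`, hence equality and `q = r`
  have hqr : q ∈ fwd hbi r := by
    show ¬ leafLT hbi q r
    intro h
    exact hrq (mem_fwd_of_leafLT h)
  have hle' := key hr hqr
  have heq : q = r := E.eq_of_b_eq hι hq hr (le_antisymm hle' hle)
  exact hrq (heq ▸ mem_fwd_self q)

/-- **The leaf order on the tail is the reverse order of the parameter.** [folklore] -/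
theorem leafLT_iff_b_lt (hι : IsOpenEmbedding ι) (hω : v ∈ omegaSet hbi ι x) {q r : F.Leaf x} (hq : q ∈ fwd hbi E.p)
    (hr : r ∈ fwd hbi E.p) : leafLT hbi q r ↔ P.b E.j (ι (Leaf.pt r)) < P.b E.j (ι (Leaf.pt q)) := by
  constructor
  · intro h
    have hle := (E.mem_fwd_iff_b_le hι hω hq hr).1 (mem_fwd_of_leafLT h)
    refine lt_of_le_of_ne hle fun heq ↦ ?_
    have := E.eq_of_b_eq hι hr hq heq
    rw [this] at h
    exact leafLT_irrefl _ h
  · intro h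
    have hmem : r ∈ fwd hbi q := (E.mem_fwd_iff_b_le hι hω hq hr).2 h.le
    rcases not_leafLT_iff.1 hmem with h' | h'
    · exact h'
    · rw [h'] at h; exact (lt_irrefl _ h).elim

end FwdTail

namespace BwdTail

variable (E : P.BwdTail hbi x)

/-- The parameter `β` is injective on the tail. [folklore] -/
theorem eq_of_b_eq (hι : IsOpenEmbedding ι) {q r : F.Leaf x} (hq : q ∈ bwd hbi E.p) (hr : r ∈ bwd hbi E.p)
    (h : P.b E.j (ι (Leaf.pt q)) = P.b E.j (ι (Leaf.pt r))) : q = r := by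
  obtain ⟨βq, -, hq', -, hbq⟩ := E.mem_S_of_mem_bwd hq
  obtain ⟨βr, -, hr', -, hbr⟩ := E.mem_S_of_mem_bwd hr
  have hpt : ι (Leaf.pt q) = ι (Leaf.pt r) := by rw [hq', hr', ← hbq, ← hbr, h]
  exact Leaf.injective_coe F x (hι.injective hpt)

/-- Backward half-leaves decrease backwards. [folklore] -/
theorem bwd_mono {p p' : F.Leaf x} (h : p' ∈ bwd hbi p) : bwd hbi p' ⊆ bwd hbi p := fun q hq hqp ↦ by
  -- `hq : ¬ p' < q`, `hqp : p < q`, `h : ¬ p < p'`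
  rcases not_leafLT_iff.1 h with h' | h'
  · rcases not_leafLT_iff.1 hq with h'' | h''
    · exact leafLT_asymm hqp (leafLT_trans h'' h')
    · exact leafLT_asymm hqp (h'' ▸ h')
  · exact hq (h' ▸ hqp)

/-- **The backward half-leaf of a tail point reaches every smaller parameter.** [folklore] -/
theorem exists_mem_bwd_b_eq (hι : IsOpenEmbedding ι) (hα : v ∈ alphaSet hbi ι x) {q : F.Leaf x} (hq : q ∈ bwd hbi E.p)
    {β : ℝ} (hβ : 0 < β) (hβq : β ≤ P.b E.j (ι (Leaf.pt q))) :
    ∃ r ∈ bwd hbi q, P.b E.j (ι (Leaf.pt r)) = β := by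
  set c : F.Leaf x → ℝ := fun r ↦ P.b E.j (ι (Leaf.pt r)) with hc
  have hsub : bwd hbi q ⊆ bwd hbi E.p := bwd_mono hq
  have hιpt : Continuous fun r : F.Leaf x ↦ ι (Leaf.pt r) := hι.continuous.comp (Leaf.continuous_coe F x)
  have hcont : ContinuousOn c (bwd hbi q) := by
    have hb : ContinuousOn (P.b E.j) (P.S E.j) := continuous_fst.comp_continuousOn (P.continuousOn_chart E.j)
    exact hb.comp hιpt.continuousOn fun r hr ↦ by obtain ⟨_, _, _, hS, _⟩ := E.mem_S_of_mem_bwd (hsub hr); exact hS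
  have hconn : IsPreconnected (c '' bwd hbi q) := (PunctureData.isPreconnected_bwd q).image c hcont
  obtain ⟨ε, hε, hsmall⟩ := P.exists_norm_chart_lt E.j hβ
  obtain ⟨_, ⟨r₁, hr₁, rfl⟩, hdist⟩ : ∃ z ∈ (fun r : F.Leaf x ↦ ι (Leaf.pt r)) '' bwd hbi q, dist z v < ε := by
    obtain ⟨z, hz, hd⟩ := Metric.mem_closure_iff.1 ((mem_alphaSet_iff.1 hα) q) ε hε
    exact ⟨z, hz, by rwa [dist_comm] at hd⟩
  obtain ⟨_, _, -, hS₁, -⟩ := E.mem_S_of_mem_bwd (hsub hr₁)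
  have hc₁ : c r₁ < β := by
    have h := hsmall _ hS₁ hdist
    have h' : |P.b E.j (ι (Leaf.pt r₁))| ≤ ‖P.chart E.j (ι (Leaf.pt r₁))‖ := by
      rw [← Real.norm_eq_abs, P.chart_apply]; exact norm_fst_le (P.b E.j (ι (Leaf.pt r₁)), P.H (ι (Leaf.pt r₁)))
    exact (le_abs_self _).trans_lt (h'.trans_lt h)
  obtain ⟨r, hr, hcr⟩ : β ∈ c '' bwd hbi q :=
    hconn.Icc_subset ⟨r₁, hr₁, rfl⟩ ⟨q, mem_bwd_self q, rfl⟩ ⟨hc₁.le, hβq⟩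
  exact ⟨r, hr, hcr⟩

/-- **Moving backward in the tail decreases the parameter**: for tail points `q`, `r`, `r` is in
the backward half-leaf of `q` iff `β(r) ≤ β(q)`. [folklore] -/
theorem mem_bwd_iff_b_le (hι : IsOpenEmbedding ι) (hα : v ∈ alphaSet hbi ι x) {q r : F.Leaf x} (hq : q ∈ bwd hbi E.p)
    (hr : r ∈ bwd hbi E.p) : r ∈ bwd hbi q ↔ P.b E.j (ι (Leaf.pt r)) ≤ P.b E.j (ι (Leaf.pt q)) := by
  have key : ∀ {q r : F.Leaf x}, q ∈ bwd hbi E.p → r ∈ bwd hbi q → P.b E.j (ι (Leaf.pt r)) ≤ P.b E.j (ι (Leaf.pt q)) := by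
    intro q r hq hr
    by_contra hlt
    rw [not_le] at hlt
    have hrp : r ∈ bwd hbi E.p := bwd_mono hq hr
    obtain ⟨_, hβr, -, -, hbr⟩ := E.mem_S_of_mem_bwd hrp
    obtain ⟨_, hβq, -, -, hbq⟩ := E.mem_S_of_mem_bwd hq
    obtain ⟨q', hq', hbq'⟩ := E.exists_mem_bwd_b_eq hι hα hrp (β := P.b E.j (ι (Leaf.pt q))) (by rw [hbq]; exact hβq.1) hlt.le
    have hq'q : q' = q := E.eq_of_b_eq hι (bwd_mono hrp hq') hq hbq'
    rw [hq'q] at hq'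
    -- `hr : ¬ q < r`, `hq' : ¬ r < q`: `q = r`
    have hqr : q = r := by
      rcases not_leafLT_iff.1 hr with h | h
      · rcases not_leafLT_iff.1 hq' with h' | h'
        · exact (leafLT_asymm h h').elim
        · exact h'
      · exact h.symm
    rw [hqr] at hlt
    exact lt_irrefl _ hlt
  refine ⟨key hq, fun hle ↦ ?_⟩
  by_contra hrq
  have hqr : q ∈ bwd hbi r := by
    show ¬ leafLT hbi r q
    intro h
    -- `r < q` means `q ∉ bwd r`… we need `r ∈ bwd q`: `¬ q < r`, which holds as `r < q`
    exact hrq (show ¬ leafLT hbi q r from leafLT_asymm h)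
  have hle' := key hr hqr
  have heq : q = r := E.eq_of_b_eq hι hq hr (le_antisymm hle' hle)
  exact hrq (heq ▸ mem_bwd_self q)

/-- **The leaf order on the backward tail is the order of the parameter.** [folklore] -/
theorem leafLT_iff_b_lt (hι : IsOpenEmbedding ι) (hα : v ∈ alphaSet hbi ι x) {q r : F.Leaf x} (hq : q ∈ bwd hbi E.p)
    (hr : r ∈ bwd hbi E.p) : leafLT hbi r q ↔ P.b E.j (ι (Leaf.pt r)) < P.b E.j (ι (Leaf.pt q)) := by
  constructor
  · intro h
    have hmem : r ∈ bwd hbi q := show ¬ leafLT hbi q r from leafLT_asymm h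
    have hle := (E.mem_bwd_iff_b_le hι hα hq hr).1 hmem
    refine lt_of_le_of_ne hle fun heq ↦ ?_
    have := E.eq_of_b_eq hι hr hq heq
    rw [this] at h
    exact leafLT_irrefl _ h
  · intro h
    have hmem : r ∈ bwd hbi q := (E.mem_bwd_iff_b_le hι hα hq hr).2 h.le
    -- `hmem : ¬ q < r`; exclude `q = r`
    rcases leafLT_trichotomy (hbi := hbi) r q with h' | h' | h'
    · exact h'
    · rw [h'] at h; exact (lt_irrefl _ h).elim
    · exact (hmem h').elim

end BwdTail

end ProngStar

end Literature.Topology.PlanarFoliations
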